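import Mathlib.LinearAlgebra.Projectivization.Cardinality
import Mathlib.FieldTheory.Finiteness
import Mathlib.Algebra.Module.Torsion.Basic
import Mathlib.RingTheory.Ideal.Quotient.Basic
import HarnessLib

/-!
# A plane over `𝔽_q` has `q + 1` lines; an `O`-module of order `q²` killed by a maximal `𝔭` with `#(O⧸𝔭) = q` has `q + 1` submodules of order `q`
# ([Hirschfeld1998] §3.1; [AtiyahMacdonald1969] Ch. 2)

Topic `Literature/Algebra/Module`; namespace `Literature.Algebra.Module.LinesInPlane`.  THEOREMS ONLY (Mathlib-only: `Projectivization.equivSubmodule`,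
`Projectivization.card_of_finrank_two`, `Module.natCard_eq_pow_finrank`, `Module.IsTorsionBySet.module`; no definition, no instance, no notation, no named
fact, no `sorry`).  Cell `hodgecm-mathlib` (D-0151), programme P6 «MOD» (crux hLiu418 = stmt-HodgeConjecture-24832, `--supports`, count-neutral): generic organ
**(L-q-lin)** for the D-line `Lines/F0_P6a_DatumOfInputs.lean` sockets `stub_LINES` ∕ `stub_SPEC` (desk F0P6c-plan (g4) 2026-09-02T01:46:33Z (L-q)
«`LineOf I y` has exactly `q + 1` elements»; L-DEAL v1 L1): the carrier `LineOf I y` is the set of `𝒪_F`-stable subgroups of ORDER `q = #κ(𝔭)` of the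
`𝔭`-torsion `A_y[𝔭](Ω)`, an `𝒪_F`-module killed by `𝔭` of order `q²`; this file counts them — `q + 1`, in particular `≥ 3`, so «some admissible `L ≠ L₀`»
(`htwo` of ★ SP-SURJ `AdmissibleIdealSpecialFibreSurjective`) holds.  HC_CM is proved only modulo the printed citations until rung 0 closes; this file is
generic and changes no count.

* §1 (finite field `k`, `#k = q`): `finrank_eq_two_of_natCard_eq_sq` (`#V = q² ⇒ dim V = 2`), `natCard_eq_iff_finrank_eq_one` (`#N = q ↔ dim N = 1`),
  **`natCard_lines_of_finrank_eq_two`** (`#{lines} = q + 1`), **`natCard_submodules_of_natCard_eq_sq`** (`#{N ≤ V : #N = q} = q + 1` when `#V = q²`),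
  `exists_ne_of_natCard_eq_sq` (for every `N₀` some line `N ≠ N₀`).
* §2 (`O`-module `M` killed by a maximal `𝔭`, `hM : Module.IsTorsionBySet O M 𝔭`): `exists_submodule_equiv` (`O`-submodules = `O⧸𝔭`-subspaces, same
  underlying sets), **`natCard_submodules_of_isTorsionBySet`** (`#M = #(O⧸𝔭)² ⇒ #{N ≤ M : #N = #(O⧸𝔭)} = #(O⧸𝔭) + 1`),
  **`exists_submodule_ne_of_isTorsionBySet`**.  (The D-line reads `A_y[𝔭](T)` as the ★ additive `𝒪_F`-module `act.Pts T` ∕ `Submodule.torsionBySet`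
  of `SerreTensorTorsionPoints`; multiplicative `Subgroup`s of the points group stable under `actΩOf` are these submodules read through `Additive`.)

## References
* [Hirschfeld1998] J. W. P. Hirschfeld, *Projective Geometries over Finite Fields*, 2nd ed. (1998), §3.1 (the number of points of `PG(n, q)`).
* [AtiyahMacdonald1969] M. F. Atiyah, I. G. Macdonald, *Introduction to Commutative Algebra* (1969), Ch. 2 (pp. 19, 22: a module annihilated by
  `𝔞` is an `A⧸𝔞`-module).
-/

namespace Literature.Algebra.Module

namespace LinesInPlane

/-! ## §1 Over a finite field: subspaces of cardinality `q` of a plane are the `q + 1` lines -/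

section Field

variable {k V : Type*} [Field k] [Finite k] [AddCommGroup V] [Module k V] [Module.Finite k V]

/-- `#V = q²` forces `dim V = 2` (`#V = q^{dim V}`, `q ≥ 2`). [cite: Hirschfeld1998, §3.1 (number of points of PG(n,q), θ(n) = (q^{n+1} − 1)∕(q − 1))] -/
theorem finrank_eq_two_of_natCard_eq_sq (hV : Nat.card V = Nat.card k ^ 2) : Module.finrank k V = 2 := by
  have h := Module.natCard_eq_pow_finrank (K := k) (V := V)
  rw [hV] at h
  exact (Nat.pow_right_injective (Finite.one_lt_card (α := k)) h).symm

/-- A subspace has `q` elements iff it is a line (`#N = q^{dim N}`). [cite: Hirschfeld1998, §3.1 (number of points of PG(n,q), θ(n) = (q^{n+1} − 1)∕(q − 1))] -/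
theorem natCard_eq_iff_finrank_eq_one (N : Submodule k V) : Nat.card N = Nat.card k ↔ Module.finrank k N = 1 := by
  have h := Module.natCard_eq_pow_finrank (K := k) (V := N)
  constructor
  · intro hN
    rw [hN] at h
    have := Nat.pow_right_injective (Finite.one_lt_card (α := k)) (show Nat.card k ^ 1 = Nat.card k ^ Module.finrank k N by rw [pow_one]; exact h)
    exact this.symm
  · intro hN
    rw [h, hN, pow_one]

omit [Module.Finite k V] in
/-- **A PLANE OVER `𝔽_q` HAS EXACTLY `q + 1` LINES** (Mathlib: `ℙ(V) ≃ {lines}`, `#ℙ(V) = q + 1`). [cite: Hirschfeld1998, §3.1 (number of points of PG(n,q), θ(n) = (q^{n+1} − 1)∕(q − 1))]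
[cite: Hirschfeld1998, §3.1 (number of points of PG(n,q), θ(n) = (q^{n+1} − 1)∕(q − 1))] -/
theorem natCard_lines_of_finrank_eq_two (hV : Module.finrank k V = 2) :
    Nat.card {N : Submodule k V // Module.finrank k N = 1} = Nat.card k + 1 := by
  rw [← Nat.card_congr (Projectivization.equivSubmodule k V), Projectivization.card_of_finrank_two k V hV]

/-- The same with lines read by CARDINALITY: `#{N ≤ V : #N = q} = q + 1` when `#V = q²`. [cite: Hirschfeld1998, §3.1 (number of points of PG(n,q), θ(n) = (q^{n+1} − 1)∕(q − 1))] -/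
theorem natCard_submodules_of_natCard_eq_sq (hV : Nat.card V = Nat.card k ^ 2) :
    Nat.card {N : Submodule k V // Nat.card N = Nat.card k} = Nat.card k + 1 := by
  rw [← natCard_lines_of_finrank_eq_two (finrank_eq_two_of_natCard_eq_sq hV)]
  exact Nat.card_congr (Equiv.subtypeEquivRight fun N => natCard_eq_iff_finrank_eq_one N)

/-- There are AT LEAST THREE lines (`q ≥ 2`), so for every line there is another one. [cite: Hirschfeld1998, §3.1 (number of points of PG(n,q), θ(n) = (q^{n+1} − 1)∕(q − 1))] -/
theorem exists_ne_of_natCard_eq_sq (hV : Nat.card V = Nat.card k ^ 2) (N₀ : Submodule k V) :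
    ∃ N : Submodule k V, Nat.card N = Nat.card k ∧ N ≠ N₀ := by
  classical
  have hc := natCard_submodules_of_natCard_eq_sq (k := k) (V := V) hV
  haveI : Finite {N : Submodule k V // Nat.card N = Nat.card k} := Nat.finite_of_card_ne_zero (by rw [hc]; omega)
  have h2 : 1 < Nat.card {N : Submodule k V // Nat.card N = Nat.card k} := by
    rw [hc]; have := Finite.one_lt_card (α := k); omega
  obtain ⟨a, b, hab⟩ := Finite.one_lt_card_iff_nontrivial.1 h2
  by_cases ha : (a : Submodule k V) = N₀
  · exact ⟨b, b.2, fun hb => hab (Subtype.ext (ha.trans hb.symm))⟩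
  · exact ⟨a, a.2, ha⟩

end Field

/-! ## §2 `𝔭`-torsion modules: an `O`-module killed by a maximal `𝔭` with `#(O ⧸ 𝔭) = q`, `#M = q²` has `q + 1` submodules of order `q` -/

section Torsion

variable {O M : Type*} [CommRing O] (𝔭 : Ideal O) [𝔭.IsMaximal] [AddCommGroup M] [Module O M]
  (hM : Module.IsTorsionBySet O M 𝔭)

omit [𝔭.IsMaximal] in
/-- For a module killed by `𝔭`, the `O`-submodules are the `O ⧸ 𝔭`-subspaces (same underlying sets): an order-preserving bijection.
[cite: AtiyahMacdonald1969, Ch. 2 (p. 19) and (p. 22)] -/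
theorem exists_submodule_equiv :
    letI := hM.module
    ∃ e : Submodule O M ≃ Submodule (O ⧸ 𝔭) M, ∀ N, ((e N : Submodule (O ⧸ 𝔭) M) : Set M) = N := by
  letI := hM.module
  haveI : IsScalarTower O (O ⧸ 𝔭) M := hM.isScalarTower
  let f : Submodule O M → Submodule (O ⧸ 𝔭) M := fun N =>
    { carrier := N
      add_mem' := fun ha hb => N.add_mem ha hb
      zero_mem' := N.zero_mem
      smul_mem' := fun c x hx => by
        obtain ⟨a, rfl⟩ := Ideal.Quotient.mk_surjective c
        have : (Ideal.Quotient.mk 𝔭 a) • x = a • x := rfl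
        rw [this]; exact N.smul_mem a hx }
  refine ⟨⟨f, fun N' => N'.restrictScalars O, fun N => ?_, fun N' => ?_⟩, fun N => rfl⟩
  · ext x; rfl
  · ext x; rfl

include hM in
/-- **`q + 1` SUBMODULES OF ORDER `q`**: an `O`-module killed by the maximal ideal `𝔭` with `#(O ⧸ 𝔭) = q` and `#M = q²` has exactly `q + 1`
submodules of order `q` — the lines of the plane `M` over `𝔽_q = O ⧸ 𝔭` (for the P6 HEART: the `q + 1` lines `H ⊂ A_y[𝔭](Ω)`, `𝒪_F`-stable of
order `q`). [cite: Hirschfeld1998, §3.1 (number of points of PG(n,q), θ(n) = (q^{n+1} − 1)∕(q − 1))] [cite: AtiyahMacdonald1969, Ch. 2 (p. 19) and (p. 22)] -/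
theorem natCard_submodules_of_isTorsionBySet [Finite M] (hcard : Nat.card M = Nat.card (O ⧸ 𝔭) ^ 2) :
    Nat.card {N : Submodule O M // Nat.card N = Nat.card (O ⧸ 𝔭)} = Nat.card (O ⧸ 𝔭) + 1 := by
  letI := hM.module
  letI : Field (O ⧸ 𝔭) := Ideal.Quotient.field 𝔭
  haveI : Finite (O ⧸ 𝔭) := Nat.finite_of_card_ne_zero fun h0 => by
    have hM0 : Nat.card M ≠ 0 := Nat.card_pos.ne'
    rw [hcard, h0, zero_pow two_ne_zero] at hM0
    exact hM0 rfl
  haveI : Module.Finite (O ⧸ 𝔭) M := Module.Finite.of_finite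
  obtain ⟨e, he⟩ := exists_submodule_equiv 𝔭 hM
  rw [← natCard_submodules_of_natCard_eq_sq (k := O ⧸ 𝔭) (V := M) hcard]
  refine Nat.card_congr (e.subtypeEquiv fun N => ?_)
  have : Nat.card (e N) = Nat.card N := Nat.card_congr (Equiv.setCongr (he N))
  rw [this]

include hM in
/-- For every submodule of order `q` there is ANOTHER one (`q + 1 ≥ 3`). [cite: Hirschfeld1998, §3.1 (number of points of PG(n,q), θ(n) = (q^{n+1} − 1)∕(q − 1))] -/
theorem exists_submodule_ne_of_isTorsionBySet [Finite M] (hcard : Nat.card M = Nat.card (O ⧸ 𝔭) ^ 2) (N₀ : Submodule O M) :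
    ∃ N : Submodule O M, Nat.card N = Nat.card (O ⧸ 𝔭) ∧ N ≠ N₀ := by
  letI := hM.module
  letI : Field (O ⧸ 𝔭) := Ideal.Quotient.field 𝔭
  haveI : Finite (O ⧸ 𝔭) := Nat.finite_of_card_ne_zero fun h0 => by
    have hM0 : Nat.card M ≠ 0 := Nat.card_pos.ne'
    rw [hcard, h0, zero_pow two_ne_zero] at hM0
    exact hM0 rfl
  haveI : Module.Finite (O ⧸ 𝔭) M := Module.Finite.of_finite
  obtain ⟨e, he⟩ := exists_submodule_equiv 𝔭 hM
  obtain ⟨N', hN', hne⟩ := exists_ne_of_natCard_eq_sq (k := O ⧸ 𝔭) (V := M) hcard (e N₀)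
  refine ⟨e.symm N', ?_, fun h => hne ?_⟩
  · have : Nat.card (e (e.symm N')) = Nat.card (e.symm N') := Nat.card_congr (Equiv.setCongr (he _))
    rw [← this, Equiv.apply_symm_apply]; exact hN'
  · rw [← h, Equiv.apply_symm_apply]

end Torsion

end LinesInPlane

end Literature.Algebra.Module
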